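import Literature.AlgebraicGeometry.ShimuraVarieties.UnitaryShimuraCurveRecord
import Literature.NumberTheory.Automorphic.UnitaryGroupHeckeConjugatePlace
import Literature.NumberTheory.Automorphic.GLnAdelicStructure
import HarnessLib

/-!
# The orientation test at a diagonal CM pair of the unitary Shimura curve record: the Artin idèle `(ϖ_w⁻¹)_w`, its
# reciprocity factor `c(s)/s = (ϖ at w, ϖ̄⁻¹ at cw)`, and the twist `d ∈ K t₁(w) K` (HEART-FROB §K (I) «K-TEST»)

Topic `NumberTheory/Automorphic/Liu2021/AppendixC`; namespace `Literature.NumberTheory.Automorphic.Liu2021.AppendixC`.  THEOREMS ONLY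
(no definition, no instance, no notation, no named fact, no `sorry`), over ★ `UnitaryShimuraCurveRecord` (`IsDiagTwistGS`, the twist of
the reciprocity clause (F3)), ★ `UnitaryShimuraCanonicalModel` (`IsArtinCorrespondent`, `finiteIdeleClass`, `recipFactor`), ★
`GLnAdelicStructure` (`uniformizerIdele`), ★ `HeckeCharacter` (`localUnits`), ★ `GlobalReciprocityLawProofs` (`theta_frobenius`), ★
`UnitaryGroupHyperspecialHecke` (`heckeElementAt`, `IsHyperspecialAt`) and ★ `UnitaryGroupHeckeConjugatePlace`.  Cell `hodgecm-mathlib`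
(D-0151), P6 «MOD programme» (crux hLiu418 = stmt-HodgeConjecture-24832, `--supports`): the **K-TEST** of `Cruxes/HLiu418/HEART-FROB.md` §K (I)
(desk F0P6a-plan; LEAD F0P6-plan rulings M-14 (2), M-14a (1)): «`IsArtinCorrespondent τ s σ → s = (ϖ_w⁻¹)_w → IsDiagTwistGS w (recipFactor s) d
→ (b self-dual 𝒪_v-basis of the hyperspecial lattice) → d ∈ Kc * t₁ * Kc`».  The file kernel-checks every arrow of that chain from the
DEFINITIONS of the record; it asserts nothing about Shimura varieties (no field of the record is used — only the shapes of its clauses).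
HC_CM is proved only modulo the printed citations until rung 0 closes; this file changes no count.

THE MATHEMATICS.  `L` a CM field, `c` its complex conjugation, `L⁺` its maximal real subfield, `J⋆ ∈ M₂(L)` hermitian, `w` a finite place of
`L` SPLIT over `v = w ∩ L⁺` (`c w ≠ w`), `ϖ ∈ L_w^×` (any unit; for the door, the chosen uniformizer).  Let `s := (ϖ⁻¹)_w ∈ 𝔸_{L,f}^×`.
(K0) ARTIN SIDE: the class of `(1_∞, s)` in `C_L` is the INVERSE of the class of the prime idèle `⟨ϖ⟩_w` (★ `localUnits`), so the
correspondence `IsArtinCorrespondent τ s σ` («`γ^{ab} = ( s , L)⁻¹`», [Milne2005ShimuraVarieties] (59) `art = rec⁻¹`) reads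
«`γ^{ab} = (⟨ϖ⟩_w , L)`», and by the reciprocity law (★ `theta_frobenius`, [CasselsFrohlichANT1967] VII 4.2 (iii)) such a `γ` restricts to the
ARITHMETIC Frobenius at `w` on every finite abelian `M ∕ L` unramified at `w`.  (K1) IDÈLE SIDE: the reciprocity factor of the CM pair
(★ `recipFactor L s = c(s) · s⁻¹`, [Milne2005ShimuraVarieties] (60)–(61)) is `ϖ` at `w`, `c_* ϖ⁻¹` at `cw = c⁻¹ w`, and `1` elsewhere.
(K2) MATRIX SIDE: a matrix `d ∈ GL₂(𝔸_{L,f})` with `d w₀ = t w₀`, `d w₁ = w₁` for an `L`-basis `(w₀, w₁)` of `L²` has `u`-component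
`d_u = B_u diag(t_u, 1) B_u⁻¹`, `B_u = [w₀ w₁]`.  (K3) THE TEST: for the twist `d ∈ U(J⋆)(𝔸_{L⁺,f})` of the CM pair `(L·w₀, w₀^⊥)`
(★ `IsDiagTwistGS L J⋆ w₀ (recipFactor L s) d`, the `d` of the reciprocity clause (F3) of ★ `RecordGS`), a level `K` hyperspecial at `v`, `J⋆` of
good reduction at `w`, and `(w₀, w₁)` an `𝒪_w`-basis of the standard lattice read in the `w`-frame (`B ∈ GL₂(𝒪_w)`, «self-dual `𝒪_v`-basis of
the hyperspecial lattice»): **`d ∈ K t₁(w; ϖ) K`** with `t₁(w; ϖ) = ι_v e_w⁻¹ diag(ϖ, 1)` = ★ `heckeElementAt … ⟨w, rfl⟩ … ϖ 1` — the door's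
`t₁`.  OUTCOME of the test: **«K-TEST: t₁»** (`k = 0` at CM pairs, as HEART-FROB §K (I) predicts), because `(c(s) s⁻¹)_w = c_*(s_{cw}) · s_w⁻¹ = 1 · ϖ`.

* §0 `finiteIdeleClass_uniformizerIdele`, `finiteIdeleClass_uniformizerIdele_inv`, **`isArtinCorrespondent_uniformizerIdele_inv_iff`**,
  `absRestrictNormalHom_eq_galFrob_of_isArtinCorrespondent`.
* §1 **`recipFactor_uniformizerIdele_inv_apply_self`** (`= ϖ` at `w`), `recipFactor_uniformizerIdele_inv_apply_of_ne` (`= 1` off `{w, c⁻¹ w}`; the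
  value `c_* ϖ⁻¹` at `c⁻¹ w` is not needed by the test and is not typed).
* §2 `finiteAdeleEval_comp_adelicVecFin`, `evalAt_mulVec_of_mulVec_eq`, `mul_eq_mul_diagonal_of_mulVec_col`, `eq_one_of_mul_eq_self_of_det_ne_zero`.
* §3 **`mem_doubleCoset_heckeElementAt_of_isDiagTwistGS`** (the test; its proof shows `d_{u′} = 1` off `v`, `d = ι_v(d_v)` and
  `e_w(d_v) = B diag(ϖ,1) B⁻¹` on the way).
* §4 `mk_mem_orbit_mk_of_mem_doubleCoset`, **`recip_cmPoint_mem_doubleCoset_heckeElementAt`** (ref1 (K4): the record's clause (F3) at the CM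
  point `[τw₀, 1]` + §3 ⇒ `σ • [τw₀, 1] = [τw₀, d]` with `d ∈ K t₁ K`, `dK ∈ orbit K (t₁K)` — the door's token).

## References
* [Milne2005ShimuraVarieties] J. S. Milne, *Introduction to Shimura varieties* (2005), (59) p. 107, (60)–(62) and Def. 12.5–12.8 pp. 113–114.
* [Deligne1979ShimuraVarieties] P. Deligne, *Variétés de Shimura*, Corvallis 1979, 0.8, 2.2.3–2.2.5.
* [CasselsFrohlichANT1967] J. Tate, *Global class field theory*, in Cassels–Fröhlich (1967), Ch. VII §4.2 Cor. (iii), 5.4.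
* [Liu2021] Y. Liu, *Fourier–Jacobi cycles and arithmetic relative trace formula*, Camb. J. Math. 9 (2021), Rem. C.2, Prop. D.8 (3).
* [HarrisTaylorAMS2001] M. Harris, R. Taylor, *The geometry and cohomology of some simple Shimura varieties* (2001), §III.4.
-/

set_option autoImplicit false

noncomputable section

open NumberField IsDedekindDomain Matrix
open scoped Matrix Pointwise
open Literature.NumberTheory.Automorphic Literature.NumberTheory.Automorphic.UnitaryGroup
open Literature.NumberTheory.GaloisRepresentations
open Literature.AlgebraicGeometry.ShimuraVarieties Literature.AlgebraicGeometry.ShimuraVarieties.UnitaryCanonicalModel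

namespace Literature.NumberTheory.Automorphic.Liu2021.AppendixC

variable (L : Type) [Field L] [NumberField L]

/-! ## §0 The Artin side: `s = (ϖ⁻¹)_w` corresponds to `γ^{ab} = (⟨ϖ⟩_w , L)`, the arithmetic Frobenius -/

/-- The idèle class of the finite idèle `(ϖ)_w` IS the class of the prime idèle `⟨ϖ⟩_w = (1_∞, (ϖ)_w)` of the reciprocity files
(★ `localUnits`): both are `(1_∞, mulSingle_w ϖ)`. [cite: Milne2005ShimuraVarieties, (59) p. 107] -/
theorem finiteIdeleClass_uniformizerIdele (w : HeightOneSpectrum (𝓞 L)) (ϖ : (w.adicCompletion L)ˣ) :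
    finiteIdeleClass L (uniformizerIdele L w ϖ) = QuotientGroup.mk (localUnits w ϖ) := by
  unfold finiteIdeleClass
  congr 1

/-- Hence the class of `s := (ϖ⁻¹)_w` is the INVERSE of the class of `⟨ϖ⟩_w`. [cite: Milne2005ShimuraVarieties, (59) p. 107] -/
theorem finiteIdeleClass_uniformizerIdele_inv (w : HeightOneSpectrum (𝓞 L)) (ϖ : (w.adicCompletion L)ˣ) :
    finiteIdeleClass L (uniformizerIdele L w ϖ)⁻¹ = (QuotientGroup.mk (localUnits w ϖ))⁻¹ := by
  rw [← finiteIdeleClass_uniformizerIdele]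
  -- `finiteIdeleClass` is the composite homomorphism `C_L ← 𝕀_L ← 𝔸_{L,f}^×`
  have hφ : ∀ s : (FiniteAdeleRing (𝓞 L) L)ˣ, finiteIdeleClass L s =
      ((QuotientGroup.mk' (principalIdeles L)).comp
        (Units.map ((MonoidHom.inr (InfiniteAdeleRing L) (FiniteAdeleRing (𝓞 L) L) :
          FiniteAdeleRing (𝓞 L) L →* AdeleRing (𝓞 L) L)))) s := fun _ => rfl
  rw [hφ, hφ, map_inv]

/-- **`IsArtinCorrespondent τ (ϖ⁻¹)_w σ` unfolded**: `σ` corresponds to `s = (ϖ⁻¹)_w` iff `σ` restricts (along some `L`-embedding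
`e : L̄ → ℂ`) to a `γ ∈ Γ_L` whose abelianised class is `( ⟨ϖ⟩_w , L)` — the two inverses of [Milne2005ShimuraVarieties] (59)
(`art = rec⁻¹`) and of `s = ϖ⁻¹` cancel.  This is the first arrow of the K-TEST chain. [cite: Milne2005ShimuraVarieties, (59) p. 107]
[cite: Deligne1979ShimuraVarieties, 0.8 and 2.2.3] -/
theorem isArtinCorrespondent_uniformizerIdele_inv_iff (τ : L →+* ℂ) (w : HeightOneSpectrum (𝓞 L)) (ϖ : (w.adicCompletion L)ˣ)
    (σ : ℂ ≃+* ℂ) :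
    IsArtinCorrespondent L τ (uniformizerIdele L w ϖ)⁻¹ σ ↔
      letI : Algebra L ℂ := τ.toAlgebra
      ∃ (e : AlgebraicClosure L →ₐ[L] ℂ) (γ : Field.absoluteGaloisGroup L),
        (∀ x : AlgebraicClosure L, e (Field.absoluteGaloisGroup.toAlgEquiv L γ x) = σ (e x)) ∧
          absGaloisAbProj L γ = (isGlobalReciprocitySystem_artinMap L).theta (QuotientGroup.mk (localUnits w ϖ)) := by
  unfold IsArtinCorrespondent
  rw [finiteIdeleClass_uniformizerIdele_inv, map_inv, inv_inv]

/-- **The `γ` corresponding to `s = (ϖ_w⁻¹)_w` is an ARITHMETIC Frobenius at `w`** on every finite abelian `M ∕ L` (inside `L̄`)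
unramified at `w`, for `ϖ = ϖ_w` the chosen uniformizer: ★ `theta_frobenius` (`( ⟨ϖ_w⟩ , L)|_M = Frob_w`, Tate VII 4.2 (iii)).  So in
the reciprocity clause (F3) the automorphism `σ_w` with `art_L((ϖ_w⁻¹)_w) = σ_w|_{L^{ab}}` is the arithmetic Frobenius — the `σ` that ★
`IntegralModel.geomReductionMap_smul_of_isAbsArithFrob` turns into the geometric Frobenius `F̃` on the special fibre.
[cite: CasselsFrohlichANT1967, Ch. VII §4.2 Corollary (iii) and 5.4 (PDF pp. 211–213)] [cite: Milne2005ShimuraVarieties, (59) p. 107] -/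
theorem absRestrictNormalHom_eq_galFrob_of_isArtinCorrespondent (τ : L →+* ℂ) (w : HeightOneSpectrum (𝓞 L)) (σ : ℂ ≃+* ℂ)
    (M : IntermediateField L (AlgebraicClosure L)) [FiniteDimensional L M] [NumberField M] [IsAbelianGalois L M]
    (hunr : Algebra.IsUnramifiedIn (𝓞 M) w.asIdeal)
    (h : IsArtinCorrespondent L τ (uniformizerIdele L w (HeckeCharacter.uniformizer L w))⁻¹ σ) :
    letI : Algebra L ℂ := τ.toAlgebra
    ∃ (e : AlgebraicClosure L →ₐ[L] ℂ) (γ : Field.absoluteGaloisGroup L),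
      (∀ x : AlgebraicClosure L, e (Field.absoluteGaloisGroup.toAlgEquiv L γ x) = σ (e x)) ∧
        absRestrictNormalHom M γ = galFrob L M w := by
  obtain ⟨e, γ, he, hγ⟩ := (isArtinCorrespondent_uniformizerIdele_inv_iff L τ w _ σ).1 h
  exact ⟨e, γ, he, theta_frobenius M hunr hγ⟩

/-! ## §1 The idèle side: `c(s) s⁻¹ = (ϖ at w, c_* ϖ⁻¹ at cw, 1 elsewhere)` for `s = (ϖ⁻¹)_w` -/

section Idele

variable [IsCMField L]

variable (w : HeightOneSpectrum (𝓞 L)) (ϖ : (w.adicCompletion L)ˣ)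

/-- **`(c(s) s⁻¹)_w = ϖ`** for `s = (ϖ⁻¹)_w` at a SPLIT place (`c w ≠ w`): `c(s)_w = c_*(s_{c⁻¹ w}) = c_*(1) = 1` and `(s⁻¹)_w = ϖ`.
This is the sign that decides the test. [cite: Milne2005ShimuraVarieties, (60)–(61) p. 114] [cite: Liu2021, Rem. C.2 l. 4604–4608] -/
theorem recipFactor_uniformizerIdele_inv_apply_self (hw : IsCMField.complexConj L • w ≠ w) :
    recipFactor L (uniformizerIdele L w ϖ)⁻¹ w = ϖ := by
  have hne : (IsCMField.complexConj L)⁻¹ • w ≠ w := by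
    intro h
    apply hw
    conv_lhs => rw [← h]
    rw [smul_inv_smul]
  unfold recipFactor
  rw [inv_inv, ← map_inv]
  change conjFiniteAdele (↥(maximalRealSubfield L)) L (IsCMField.complexConj L)
      ((uniformizerIdele L w ϖ⁻¹ : (FiniteAdeleRing (𝓞 L) L)ˣ) : FiniteAdeleRing (𝓞 L) L) w *
    ((uniformizerIdele L w ϖ : (FiniteAdeleRing (𝓞 L) L)ˣ) : FiniteAdeleRing (𝓞 L) L) w = ϖ
  rw [conjFiniteAdele_apply_apply, uniformizerIdele_apply_of_ne (K := L) (v := w) ϖ⁻¹ hne, map_one, one_mul, uniformizerIdele_apply_self]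

/-- **`(c(s) s⁻¹)_u = 1` at every place `u ∉ {w, c⁻¹ w}`** (so away from `v` the twist of the CM pair is trivial).
[cite: Milne2005ShimuraVarieties, (60)–(61) p. 114] [cite: Liu2021, Rem. C.2 l. 4604–4608] -/
theorem recipFactor_uniformizerIdele_inv_apply_of_ne {u : HeightOneSpectrum (𝓞 L)} (hu : u ≠ w)
    (hu' : u ≠ (IsCMField.complexConj L)⁻¹ • w) :
    recipFactor L (uniformizerIdele L w ϖ)⁻¹ u = 1 := by
  have hne : (IsCMField.complexConj L)⁻¹ • u ≠ w := by
    intro h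
    apply hu'
    rw [← h, algEquiv_inv_eq_self (↥(maximalRealSubfield L)) (IsCMField.complexConj_ne_one L), smul_smul,
      algEquiv_mul_self_eq_one (↥(maximalRealSubfield L)) (IsCMField.complexConj_ne_one L), one_smul]
  unfold recipFactor
  rw [inv_inv, ← map_inv]
  change conjFiniteAdele (↥(maximalRealSubfield L)) L (IsCMField.complexConj L)
      ((uniformizerIdele L w ϖ⁻¹ : (FiniteAdeleRing (𝓞 L) L)ˣ) : FiniteAdeleRing (𝓞 L) L) u *
    ((uniformizerIdele L w ϖ : (FiniteAdeleRing (𝓞 L) L)ˣ) : FiniteAdeleRing (𝓞 L) L) u = 1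
  rw [conjFiniteAdele_apply_apply, uniformizerIdele_apply_of_ne (K := L) (v := w) ϖ⁻¹ hne, map_one, one_mul,
    uniformizerIdele_apply_of_ne (K := L) (v := w) ϖ hu]

end Idele

/-! ## §2 The matrix side: eigen-equations in `(𝔸_{L,f})²` read at a place -/

section MatrixSide

/-- The `u`-component of the adelic vector of `x ∈ Lⁿ` is `x` read in `L_uⁿ`. [cite: Milne2005ShimuraVarieties, (60)–(61) p. 114] -/
theorem finiteAdeleEval_comp_adelicVecFin {n : ℕ} (x : Fin n → L) (u : HeightOneSpectrum (𝓞 L)) :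
    (AdelicGroupData.finiteAdeleEval L u) ∘ adelicVecFin L x = fun i => algebraMap L (u.adicCompletion L) (x i) := by
  funext i
  change algebraMap L (FiniteAdeleRing (𝓞 L) L) (x i) u = _
  rw [FiniteAdeleRing.algebraMap_apply]
  exact adicCompletion_coe_eq_algebraMap (𝓞 L) L u (x i)

/-- **An adelic eigen-equation read at a place**: if `g · x = y` in `(𝔸_{L,f})ⁿ` for `x ∈ Lⁿ`, then `g_u · x = y_u` in `L_uⁿ`
(`g_u = GLn.evalAt u g`). [cite: Milne2005ShimuraVarieties, (60)–(62) p. 114] -/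
theorem evalAt_mulVec_of_mulVec_eq {n : ℕ} (g : GL (Fin n) (FiniteAdeleRing (𝓞 L) L)) {x : Fin n → L}
    {y : Fin n → FiniteAdeleRing (𝓞 L) L}
    (h : (g : Matrix (Fin n) (Fin n) (FiniteAdeleRing (𝓞 L) L)) *ᵥ adelicVecFin L x = y) (u : HeightOneSpectrum (𝓞 L)) :
    (GLn.evalAt n L u g : Matrix (Fin n) (Fin n) (u.adicCompletion L)) *ᵥ (fun i => algebraMap L (u.adicCompletion L) (x i)) =
      fun i => y i u := by
  have hmap : (GLn.evalAt n L u g : Matrix (Fin n) (Fin n) (u.adicCompletion L)) =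
      (g : Matrix (Fin n) (Fin n) (FiniteAdeleRing (𝓞 L) L)).map (AdelicGroupData.finiteAdeleEval L u) :=
    Matrix.ext fun i j => rfl
  funext i
  rw [hmap, ← finiteAdeleEval_comp_adelicVecFin, ← RingHom.map_mulVec, h]
  rfl

/-- **Columns that are eigenvectors**: if every column `b_j` of `B` satisfies `D · b_j = e_j · b_j`, then `D · B = B · diag(e)`.
[cite: Milne2005ShimuraVarieties, Def. 12.5 p. 113] -/
theorem mul_eq_mul_diagonal_of_mulVec_col {R : Type*} [CommRing R] {n : ℕ} (D B : Matrix (Fin n) (Fin n) R) (e : Fin n → R)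
    (h : ∀ j, D *ᵥ (fun i => B i j) = e j • fun i => B i j) : D * B = B * Matrix.diagonal e := by
  ext i j
  rw [Matrix.mul_diagonal, mul_comm]
  have hij := congrFun (h j) i
  rw [Pi.smul_apply, smul_eq_mul] at hij
  rw [← hij]
  rfl

/-- If `D · B = B` with `det B ≠ 0` over a field then `D = 1`. [cite: Milne2005ShimuraVarieties, Def. 12.5 p. 113] -/
theorem eq_one_of_mul_eq_self_of_det_ne_zero {R : Type*} [Field R] {n : ℕ} {D B : Matrix (Fin n) (Fin n) R} (h : D * B = B)
    (hB : B.det ≠ 0) : D = 1 := by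
  have hBu : IsUnit B.det := isUnit_iff_ne_zero.2 hB
  calc D = D * B * B⁻¹ := by rw [Matrix.mul_assoc, Matrix.mul_nonsing_inv B hBu, Matrix.mul_one]
    _ = 1 := by rw [h, Matrix.mul_nonsing_inv B hBu]

end MatrixSide

/-! ## §3 The test: the twist of the diagonal CM pair lies in `K t₁(w; ϖ) K` -/

section Test

variable [IsCMField L] (Jstar : Matrix (Fin 2) (Fin 2) L)

/-- **K-TEST (HEART-FROB.md §K (I)) — OUTCOME «t₁».**  Let `w` be a place of the CM field `L` split over `v = w ∩ L⁺`, `ϖ ∈ L_w^×`,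
`s := (ϖ⁻¹)_w` (the idèle of the arithmetic Frobenius at `w`, §0), `K ≤ U(J⋆)(𝔸_{L⁺,f})` hyperspecial at `v` with `J⋆` of good
reduction at `w` (`J⋆_w ∈ GL₂(𝒪_w)`), `(w₀, w₁)` a `J⋆`-orthogonal pair of vectors of `L²` (`⟨w₁, w₀⟩ = 0`) forming a basis (`det ≠ 0`)
which, read at `w`, is an `𝒪_w`-basis of the standard lattice (`B = [w₀ w₁] ∈ GL₂(𝒪_w)`, «a self-dual `𝒪_v`-basis of the hyperspecial
lattice» in the `w`-frame `U(J⋆)(L⁺_v) ≅ GL₂(L_w)`), and let `d ∈ U(J⋆)(𝔸_{L⁺,f})` be the twist of the CM pair `(L·w₀, w₀^⊥)` with factor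
`c(s)s⁻¹` — the `d` of the reciprocity clause (F3) of ★ `RecordGS` (`IsDiagTwistGS L J⋆ w₀ (recipFactor L s) d`).  THEN
**`d ∈ K · t₁(w; ϖ) · K`** for the door's Hecke element `t₁(w; ϖ) = ι_v e_w⁻¹ diag(ϖ, 1)` (★ `heckeElementAt … ⟨w, rfl⟩ … ϖ 1`):
`d_u = 1` off `v` (§1–§2), `e_w(d_v) = B diag(ϖ, 1) B⁻¹` (`(c(s)s⁻¹)_w = ϖ`, §1), and `ι_v e_w⁻¹ B^{±1} ∈ K` (hyperspecial).  So the
reciprocity law at a diagonal CM pair moves the point by the RIGHT `t₁`-TRANSLATE — `k = 0`, orientation `t₁` (not `t₁⁻¹`).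
[cite: Milne2005ShimuraVarieties, Def. 12.8 with (62) p. 114; (59)–(61)] [cite: Deligne1979ShimuraVarieties, 2.2.4]
[cite: Liu2021, Rem. C.2 l. 4604–4608; Prop. D.8 (3) p. 135] [cite: HarrisTaylorAMS2001, §III.4, pp. 108–110] -/
theorem mem_doubleCoset_heckeElementAt_of_isDiagTwistGS {w : HeightOneSpectrum (𝓞 L)}
    {Kc : Subgroup ↥(finAdelic (↥(maximalRealSubfield L)) L (IsCMField.complexConj L) 2 Jstar)}
    (hK : IsHyperspecialAt (↥(maximalRealSubfield L)) L (IsCMField.complexConj L) 2 Jstar Kc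
      (w.under (𝓞 ↥(maximalRealSubfield L))))
    (hc : IsCMField.complexConj L ≠ 1) (hJ : (Jstar.map (IsCMField.complexConj L))ᵀ = Jstar)
    (hw : IsCMField.complexConj L • w ≠ w) (hJw : IsUnit (placeForm Jstar w)) (hJi : hJw.unit ∈ glInt 2 (w.adicCompletion L))
    (ϖ : (w.adicCompletion L)ˣ) {w₀ w₁ : Fin 2 → L} (hperp : Literature.AlgebraicGeometry.ShimuraVarieties.hermForm (cmConjRingHom L) Jstar w₁ w₀ = 0)
    (hdet : (Matrix.of fun i j : Fin 2 => (![w₀, w₁] : Fin 2 → Fin 2 → L) j i).det ≠ 0)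
    (B : GL (Fin 2) (w.adicCompletion L))
    (hB : ∀ i j : Fin 2, (B : Matrix (Fin 2) (Fin 2) (w.adicCompletion L)) i j =
      algebraMap L (w.adicCompletion L) ((![w₀, w₁] : Fin 2 → Fin 2 → L) j i))
    (hBint : B ∈ glInt 2 (w.adicCompletion L))
    {d : ↥(finAdelic (↥(maximalRealSubfield L)) L (IsCMField.complexConj L) 2 Jstar)}
    (hd : IsDiagTwistGS L Jstar w₀ (recipFactor L (uniformizerIdele L w ϖ)⁻¹) d) :
    d ∈ DoubleCoset.doubleCoset
      (heckeElementAt (↥(maximalRealSubfield L)) L (IsCMField.complexConj L) 2 Jstar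
        (⟨w, rfl⟩ : UnitaryGroup.PlacesOver L (w.under (𝓞 ↥(maximalRealSubfield L)))) hc hJ hw hJw ϖ 1) Kc Kc := by
  classical
  -- names
  set v : HeightOneSpectrum (𝓞 ↥(maximalRealSubfield L)) := w.under (𝓞 ↥(maximalRealSubfield L)) with hvdef
  set wv : UnitaryGroup.PlacesOver L v := ⟨w, rfl⟩ with hwv
  set t : FiniteAdeleRing (𝓞 L) L := recipFactor L (uniformizerIdele L w ϖ)⁻¹ with htdef
  set e := localPiSplitEquiv (IsCMField.complexConj L) Jstar hc hJ wv hw hJw with hedef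
  set φ : GL (Fin 2) (w.adicCompletion L) →* ↥(finAdelic (↥(maximalRealSubfield L)) L (IsCMField.complexConj L) 2 Jstar) :=
    (inclPlace (↥(maximalRealSubfield L)) L (IsCMField.complexConj L) 2 Jstar v).comp e.symm.toMonoidHom with hφ
  -- the columns matrix at a place `u`
  set M₀ : Matrix (Fin 2) (Fin 2) L := Matrix.of fun i j : Fin 2 => (![w₀, w₁] : Fin 2 → Fin 2 → L) j i with hM₀
  have hBm : ∀ u : HeightOneSpectrum (𝓞 L), ∀ j : Fin 2,
      (fun i => (M₀.map (algebraMap L (u.adicCompletion L))) i j) =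
        fun i => algebraMap L (u.adicCompletion L) ((![w₀, w₁] : Fin 2 → Fin 2 → L) j i) := fun u j => rfl
  -- the two eigen-equations, read at every place
  obtain ⟨h0, h1'⟩ := hd
  have h1 := h1' w₁ hperp
  have hcol : ∀ u : HeightOneSpectrum (𝓞 L), ∀ j : Fin 2,
      (GLn.evalAt 2 L u (d : GL (Fin 2) (FiniteAdeleRing (𝓞 L) L)) : Matrix (Fin 2) (Fin 2) (u.adicCompletion L)) *ᵥ
          (fun i => (M₀.map (algebraMap L (u.adicCompletion L))) i j) =
        (![t u, 1] : Fin 2 → u.adicCompletion L) j • fun i => (M₀.map (algebraMap L (u.adicCompletion L))) i j := by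
    intro u j
    fin_cases j
    · rw [hBm]
      change _ *ᵥ (fun i => algebraMap L (u.adicCompletion L) (w₀ i)) = t u • fun i => algebraMap L (u.adicCompletion L) (w₀ i)
      rw [evalAt_mulVec_of_mulVec_eq L _ h0 u]
      funext i
      rw [Pi.smul_apply, Pi.smul_apply, smul_eq_mul, smul_eq_mul]
      change t u * (adelicVecFin L w₀ i) u = _
      exact congrArg (fun z => t u * z) (congrFun (finiteAdeleEval_comp_adelicVecFin L w₀ u) i)
    · rw [hBm]
      change _ *ᵥ (fun i => algebraMap L (u.adicCompletion L) (w₁ i)) =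
        (1 : u.adicCompletion L) • fun i => algebraMap L (u.adicCompletion L) (w₁ i)
      rw [evalAt_mulVec_of_mulVec_eq L _ h1 u, one_smul, ← finiteAdeleEval_comp_adelicVecFin]
      rfl
  have hmul : ∀ u : HeightOneSpectrum (𝓞 L),
      (GLn.evalAt 2 L u (d : GL (Fin 2) (FiniteAdeleRing (𝓞 L) L)) : Matrix (Fin 2) (Fin 2) (u.adicCompletion L)) *
          M₀.map (algebraMap L (u.adicCompletion L)) =
        M₀.map (algebraMap L (u.adicCompletion L)) * Matrix.diagonal ![t u, 1] := fun u =>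
    mul_eq_mul_diagonal_of_mulVec_col _ _ _ (hcol u)
  -- (i) away from `w` and `(IsCMField.complexConj L)⁻¹ w` the component is trivial
  have hone : ∀ u : HeightOneSpectrum (𝓞 L), u ≠ w → u ≠ (IsCMField.complexConj L)⁻¹ • w →
      GLn.evalAt 2 L u (d : GL (Fin 2) (FiniteAdeleRing (𝓞 L) L)) = 1 := by
    intro u hu hu'
    have ht1 : t u = 1 := recipFactor_uniformizerIdele_inv_apply_of_ne L w ϖ hu hu'
    have hdet' : (M₀.map (algebraMap L (u.adicCompletion L))).det ≠ 0 := by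
      rw [← RingHom.mapMatrix_apply, ← RingHom.map_det]
      exact (map_ne_zero_iff _ (algebraMap L (u.adicCompletion L)).injective).2 hdet
    refine Units.ext ?_
    rw [Units.val_one]
    refine eq_one_of_mul_eq_self_of_det_ne_zero (B := M₀.map (algebraMap L (u.adicCompletion L))) ?_ hdet'
    rw [hmul u, ht1]
    have : (![(1 : u.adicCompletion L), 1] : Fin 2 → u.adicCompletion L) = fun _ => 1 := by
      funext j; fin_cases j <;> rfl
    rw [this, Matrix.diagonal_one, Matrix.mul_one]
  -- (ii) hence `d_{u'} = 1` for every place `u' ≠ v` of `L⁺`, and `d = ι_v(d_v)`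
  have hev : ∀ u' : HeightOneSpectrum (𝓞 ↥(maximalRealSubfield L)), u' ≠ v →
      evalPlace (↥(maximalRealSubfield L)) L (IsCMField.complexConj L) 2 Jstar u' d = 1 := by
    intro u' hu'
    refine Subtype.ext (funext fun x => ?_)
    rw [coe_evalPlace_apply]
    have hx : x.1 ≠ w := fun h => hu' (by rw [← x.2, h])
    have hx' : x.1 ≠ (IsCMField.complexConj L)⁻¹ • w := fun h => hu' (by rw [← x.2, h]; exact (PlacesOver.galInv (IsCMField.complexConj L) wv).2)
    rw [hone x.1 hx hx']
    rfl
  have hdι : d = inclPlace (↥(maximalRealSubfield L)) L (IsCMField.complexConj L) 2 Jstar v (evalPlace (↥(maximalRealSubfield L)) L (IsCMField.complexConj L) 2 Jstar v d) := by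
    refine eq_of_forall_evalPlace_eq (F := ↥(maximalRealSubfield L)) (E := L) (c := IsCMField.complexConj L) (N := 2)
      (J := Jstar) (fun u' => ?_)
    by_cases hu' : u' = v
    · subst hu'; rw [evalPlace_inclPlace]
    · rw [evalPlace_inclPlace_of_ne (↥(maximalRealSubfield L)) L (IsCMField.complexConj L) 2 Jstar hu', hev u' hu']
  -- (iii) at the frame place: `e_w(d_v) = B diag(ϖ,1) B⁻¹`
  have hBM : (B : Matrix (Fin 2) (Fin 2) (w.adicCompletion L)) = M₀.map (algebraMap L (w.adicCompletion L)) :=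
    Matrix.ext fun i j => hB i j
  have htw : t w = ϖ := recipFactor_uniformizerIdele_inv_apply_self L w ϖ hw
  have hdiag : Matrix.diagonal (![t w, 1] : Fin 2 → w.adicCompletion L) =
      ((heckeDiag 2 ϖ 1 : GL (Fin 2) (w.adicCompletion L)) : Matrix (Fin 2) (Fin 2) (w.adicCompletion L)) := by
    rw [coe_heckeDiag, htw]
    congr 1
    funext j; fin_cases j <;> rfl
  have hframe : GLn.evalAt 2 L w (d : GL (Fin 2) (FiniteAdeleRing (𝓞 L) L)) = B * heckeDiag 2 ϖ 1 * B⁻¹ := by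
    rw [eq_mul_inv_iff_mul_eq]
    refine Units.ext ?_
    rw [Units.val_mul, Units.val_mul, hBM, hmul w, hdiag]
  have hdv : evalPlace (↥(maximalRealSubfield L)) L (IsCMField.complexConj L) 2 Jstar v d = e.symm (B * heckeDiag 2 ϖ 1 * B⁻¹) := by
    apply e.injective
    rw [ContinuousMulEquiv.apply_symm_apply, hedef, localPiSplitEquiv_apply, coe_evalPlace_apply]
    exact hframe
  -- (iv) assemble: `d = φ B · t₁ · (φ B)⁻¹` with `φ B ∈ K`
  have hφB : φ B ∈ Kc := inclPlace_localPiSplitEquiv_symm_mem_of_mem_glInt hK hc hJ wv hw hJw hJi hBint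
  have ht₁ : heckeElementAt (↥(maximalRealSubfield L)) L (IsCMField.complexConj L) 2 Jstar wv hc hJ hw hJw ϖ 1 = φ (heckeDiag 2 ϖ 1) := rfl
  refine DoubleCoset.mem_doubleCoset.2 ⟨φ B, hφB, (φ B)⁻¹, Kc.inv_mem hφB, ?_⟩
  rw [ht₁, ← map_inv, ← map_mul, ← map_mul, hdι, hdv]
  rfl

end Test

/-! ## §4 At the door's token: the Frobenius-conjugate of a diagonal CM point is a right-`t₁`-translate -/

section Door

/-- **Double coset ⇒ Hecke orbit**: if `g ∈ K t K` then the coset `gK` lies in the `K`-orbit of `tK` in `G ⧸ K` — the index set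
`K t K ⧸ K` of the door's `FrobeniusDichotomy` ∕ `PointwiseFrobeniusDatumAt` (`orbit Kc (t₁ : G ⧸ Kc)`). [cite: CartierCorvallis1979, §IV.1] -/
theorem mk_mem_orbit_mk_of_mem_doubleCoset {G : Type*} [Group G] (K : Subgroup G) {t g : G} (h : g ∈ DoubleCoset.doubleCoset t K K) :
    (g : G ⧸ K) ∈ MulAction.orbit K ((t : G) : G ⧸ K) := by
  obtain ⟨x, hx, y, hy, rfl⟩ := DoubleCoset.mem_doubleCoset.1 h
  refine MulAction.mem_orbit_iff.2 ⟨⟨x, hx⟩, ?_⟩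
  rw [QuotientGroup.mk_mul_of_mem (x * t) hy]
  rfl

variable [IsCMField L] (Jstar : Matrix (Fin 2) (Fin 2) L) (τ : L →+* ℂ)

/-- **K-TEST AT THE DOOR'S TOKEN (ref1 (K4)).**  For a canonical-model record `R` of the unitary Shimura curve (★ `RecordGS`, whose
clause (F3) `recip` is Shimura reciprocity at the diagonal CM pairs), the automorphism `σ` corresponding under ★ `IsArtinCorrespondent` to
`s = (ϖ_w⁻¹)_w` — the ARITHMETIC Frobenius at `w` (§0) — moves the CM point `[τw₀, 1]` to `[τw₀, d]` with **`d ∈ K · t₁(w; ϖ_w) · K`**,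
`t₁` the door's Hecke element at `w` (★ `heckeElementAt … ⟨w, rfl⟩ … (uniformizer) 1`), hence `dK ∈ K t₁ K ⧸ K` = the index set
`orbit K (t₁ : G ⧸ K)` of the door's `FrobeniusDichotomy`: the Frobenius point is a RIGHT `t₁`-TRANSLATE — **«K-TEST: t₁» (k = 0)** in the
door's own currency.  Hypotheses as in §3 (`w` split, `K` hyperspecial at `v`, `J⋆` of good reduction at `w`, `(w₀, w₁)` orthogonal and
unimodular at `w`); the twist `d` is the one the record's clause (F3) quantifies over.
[cite: Milne2005ShimuraVarieties, Def. 12.8 with (62) p. 114; (59) p. 107] [cite: Deligne1979ShimuraVarieties, 2.2.4–2.2.5]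
[cite: Liu2021, Rem. C.2; Prop. D.8 (3) p. 135] -/
theorem recip_cmPoint_mem_doubleCoset_heckeElementAt {w : HeightOneSpectrum (𝓞 L)}
    {Kc : Subgroup ↥(finAdelic (↥(maximalRealSubfield L)) L (IsCMField.complexConj L) 2 Jstar)}
    (R : UnitaryCanonicalModel.RecordGS L Jstar τ Kc)
    (hK : IsHyperspecialAt (↥(maximalRealSubfield L)) L (IsCMField.complexConj L) 2 Jstar Kc
      (w.under (𝓞 ↥(maximalRealSubfield L))))
    (hc : IsCMField.complexConj L ≠ 1) (hJ : (Jstar.map (IsCMField.complexConj L))ᵀ = Jstar)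
    (hw : IsCMField.complexConj L • w ≠ w) (hJw : IsUnit (placeForm Jstar w)) (hJi : hJw.unit ∈ glInt 2 (w.adicCompletion L))
    (ϖ : (w.adicCompletion L)ˣ) {w₀ w₁ : Fin 2 → L} (hw₀ : (fun i => τ (w₀ i)) ∈ negCone (Jstar.map τ))
    (hperp : Literature.AlgebraicGeometry.ShimuraVarieties.hermForm (cmConjRingHom L) Jstar w₁ w₀ = 0)
    (hdet : (Matrix.of fun i j : Fin 2 => (![w₀, w₁] : Fin 2 → Fin 2 → L) j i).det ≠ 0)
    (B : GL (Fin 2) (w.adicCompletion L))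
    (hB : ∀ i j : Fin 2, (B : Matrix (Fin 2) (Fin 2) (w.adicCompletion L)) i j =
      algebraMap L (w.adicCompletion L) ((![w₀, w₁] : Fin 2 → Fin 2 → L) j i))
    (hBint : B ∈ glInt 2 (w.adicCompletion L)) :
    letI : Algebra L ℂ := τ.toAlgebra
    ∀ (σ : ℂ ≃ₐ[L] ℂ), IsArtinCorrespondent L τ (uniformizerIdele L w ϖ)⁻¹ σ.toRingEquiv →
      ∀ d : ↥(finAdelic (↥(maximalRealSubfield L)) L (IsCMField.complexConj L) 2 Jstar),
        IsDiagTwistGS L Jstar w₀ (recipFactor L (uniformizerIdele L w ϖ)⁻¹) d →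
          d ∈ DoubleCoset.doubleCoset
              (heckeElementAt (↥(maximalRealSubfield L)) L (IsCMField.complexConj L) 2 Jstar
                (⟨w, rfl⟩ : UnitaryGroup.PlacesOver L (w.under (𝓞 ↥(maximalRealSubfield L)))) hc hJ hw hJw ϖ 1) Kc Kc ∧
            ((d : ↥(finAdelic (↥(maximalRealSubfield L)) L (IsCMField.complexConj L) 2 Jstar)) :
                ↥(finAdelic (↥(maximalRealSubfield L)) L (IsCMField.complexConj L) 2 Jstar) ⧸ Kc) ∈
              MulAction.orbit Kc
                ((heckeElementAt (↥(maximalRealSubfield L)) L (IsCMField.complexConj L) 2 Jstar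
                  (⟨w, rfl⟩ : UnitaryGroup.PlacesOver L (w.under (𝓞 ↥(maximalRealSubfield L)))) hc hJ hw hJw ϖ 1 :
                    ↥(finAdelic (↥(maximalRealSubfield L)) L (IsCMField.complexConj L) 2 Jstar)) :
                  ↥(finAdelic (↥(maximalRealSubfield L)) L (IsCMField.complexConj L) 2 Jstar) ⧸ Kc) ∧
            σ • R.pts.symm (ShimuraSetGS.mk L Jstar τ Kc (fun i => τ (w₀ i)) hw₀ 1) =
              R.pts.symm (ShimuraSetGS.mk L Jstar τ Kc (fun i => τ (w₀ i)) hw₀ d) := by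
  letI : Algebra L ℂ := τ.toAlgebra
  intro σ hσ d hd
  have hmem := mem_doubleCoset_heckeElementAt_of_isDiagTwistGS L Jstar hK hc hJ hw hJw hJi ϖ hperp hdet B hB hBint hd
  refine ⟨hmem, mk_mem_orbit_mk_of_mem_doubleCoset Kc hmem, ?_⟩
  have h := R.recip σ _ hσ w₀ hw₀ d hd 1
  rwa [mul_one] at h

end Door

end Literature.NumberTheory.Automorphic.Liu2021.AppendixC

end
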